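import Literature.AnabelianGeometry.EtaleTheta.DivisorMonoidsOfGaloisCoveringConnected
import Literature.AnabelianGeometry.EtaleTheta.DivisorMonoidsOfGaloisCovering
import Literature.AnabelianGeometry.EtaleTheta.RealifiedDivisorMonoidsOfRlf
import Literature.AnabelianGeometry.EtaleTheta.TemperedFilterLevels

/-!
# [EtTh] Def. 3.3 (iii) v2 — «covering-indexed Mero»: the TOWER of universal combinatorial coverings along a tempered
# filter; `Φ₀, B₀` over print's base `D₀ = B^temp(Π^tp_X)⁰`, each covering read AT THE LEVEL OF ITS Δ^fil-CLOSURE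

S. Mochizuki, *The étale theta function …*, Publ. RIMS **45** (2009) [MochizukiEtTh2009], §3 Def. 3.1 / Prop. 3.2 (PDF
p.70), Def. 3.3 (i)(c) p.72 («`Δ^{fil,∞}_{i_H} ⊆ H`»; «`Δ^{fil,∞}_i ⊆ H` implies `Δ^{fil,∞}_i ⊆ Δ^{fil,∞}_{i_H}`»), (ii) p.73
(`Δ^fil`-coverings / `Δ^fil`-closures), (iii) pp.73–74: «`Φ₀(Y^log) := lim_{→ Z^log_∞} Div⁺(Z^log_∞)^{Gal(Z^log_∞/Y^log)}`,
`B₀(Y^log) := lim_{→} Mero(Z^log_∞)^{Gal}` — where the inductive limits range over the `Δ^fil`-closures `Z^log_∞ → Y^log` of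
`Y^log → X^log` … by (i), (c), the assignments … determine functors `Φ₀, B₀ : D₀ → Mon`» [cite: MochizukiEtTh2009, Def 3.3 p.73].
abc-iut cell, layer L2; FOUNDATIONS / v-next row «LogDivisorModel v2 (covering-indexed Mero)» (abc-iut-L2-lead R342) after
the kernel finding F-L2t3g5-1 (p447056: in the v1 class — all coverings read at ONE `Z^log_∞` — the E2 root law collapses
to `B₀ = 1`); owner abc-iut-L2-t3 lineage (gen 5) with abc-iut-w6-d058; design memo `VNEXT-LogDivisorModelV2-DESIGN.md`.
CLASS (b): new structures/defs over EXISTING v1 interfaces (`LogDivisorModel` = ONE `Z^log_∞`, unchanged; abc-iut-w6-d058's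
`GaloisAction`, `phiZero`, `bZero`, `divZeroHom`, `fZero`, `ncspZero`, `cspZero`; `ConnectedPart (BTemp Π)` of [FrdII]
Ex. 1.3); nothing landed edited; no instance / notation / Prop-fact.
* (§0 = `TemperedFilterLevels.lean`: `LevelSystem Π` — levels, `Δ^{fil,∞}_i ⊴ Π`, the level `lvl Y` of a connected tempered
  covering, `LevelSystem.ofTemperedFilter` CONSTRUCTED from a tempered filter on `X^log`, `LevelSystem.single`.)
* §1 `LogDivisorTower Π L` — per level the v1 datum `Z i` with its `GaloisAction Π` (`Δ^{fil,∞}_i` acting trivially) and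
  the PULL-BACKS `resFn`/`resDIV` along `Z_∞^{(j)} → Z_∞^{(i)}` (functorial, injective on functions, equivariant,
  compatible with log-meromorphy, constants, effectivity, Cartier-ness, (non-)cuspidality, divisors).
* §2 level change on `Φ₀`/`B₀` (`transPhi`, `transB`): functorial, commutes with pull-back and with `div₀`.
* §3 **`DivisorMonoids.ofTower T : DivisorMonoids (ConnectedPart (BTemp Π))`** — Def. 3.3 (iii) over print's `D₀` with the
  value group of `B₀(Y)` = `Mero(Z_∞^{(lvl Y)})` CHANGING WITH `Y`; every field a definition or a theorem.
* §4 `LogDivisorTower.ofGaloisAction`: a v1 model IS a one-level tower (identity pull-backs); `ofTower` of it returns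
  the v1 `B₀`/`Φ₀`/`div₀` at the underlying `Π`-sets (`rfl`); the v2 interface is inhabited.
HONEST FRAMING: an interface (data + laws quoting print), not a construction of formal schemes; multi-level inhabitants
(«Tate tower v2») are a separate NV file; nothing here bears on [IUTchIII] Cor. 3.12; typed ≠ proved.
-/

noncomputable section

namespace Literature.AnabelianGeometry.EtaleTheta

open CategoryTheory Opposite Function Literature.AlgebraicGeometry.Frobenioids Literature.AnabelianGeometry.SemiGraphs

universe u

/-! ### §1 The tower -/

/-- **Def. 3.3 (ii)–(iii), the tower of universal combinatorial coverings**: for every level `i` the Def. 3.1 /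
Prop. 3.2 datum `Z i` of `Z^log_∞ = Z_∞^{(i)}` (v1 `LogDivisorModel`) with the action of `Π` (v1 `GaloisAction`),
`Δ^{fil,∞}_i = π₁(Z_∞^{(i)})` acting trivially, and for `Δ^{fil,∞}_j ⊆ Δ^{fil,∞}_i` the pull-backs of meromorphic
functions and of log-divisors along the covering `Z_∞^{(j)} → Z_∞^{(i)}` with their laws.
[cite: MochizukiEtTh2009, Def 3.3 (iii) p.73] -/
structure LogDivisorTower (P : Type u) [Group P] [TopologicalSpace P] (L : LevelSystem P) : Type (u + 1) where
  /-- level `i`: the data of `Z_∞^{(i)}` -/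
  Z : L.I → LogDivisorModel.{u}
  /-- the tacit cusp laws of Def. 3.1 (i) at every level -/
  cuspLaws : ∀ i, (Z i).CuspLaws
  /-- `Π` acts on every level -/
  act : ∀ i, (Z i).GaloisAction P
  /-- `Δ^{fil,∞}_i` acts trivially on the functions of level `i` -/
  act_closure_fn : ∀ (i) (g : P), g ∈ L.closure i → (act i).actFn g = 1
  /-- `Δ^{fil,∞}_i` acts trivially on the log-divisors of level `i` -/
  act_closure_div : ∀ (i) (g : P), g ∈ L.closure i → (act i).actDIV g = 1
  /-- pull-back of meromorphic functions along `Z_∞^{(j)} → Z_∞^{(i)}` -/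
  resFn : ∀ {i j}, L.closure j ≤ L.closure i → ((Z i).Fn →* (Z j).Fn)
  /-- pull-back of log-divisors along `Z_∞^{(j)} → Z_∞^{(i)}` -/
  resDIV : ∀ {i j}, L.closure j ≤ L.closure i → ((Z i).DIV →* (Z j).DIV)
  /-- functoriality of `resFn`: identity -/
  resFn_refl : ∀ (i) (f : (Z i).Fn), resFn (le_refl (L.closure i)) f = f
  /-- functoriality of `resFn`: composition -/
  resFn_trans : ∀ {i j k} (hij : L.closure j ≤ L.closure i) (hjk : L.closure k ≤ L.closure j) (f : (Z i).Fn),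
    resFn (hjk.trans hij) f = resFn hjk (resFn hij f)
  /-- functoriality of `resDIV`: identity -/
  resDIV_refl : ∀ (i) (d : (Z i).DIV), resDIV (le_refl (L.closure i)) d = d
  /-- functoriality of `resDIV`: composition -/
  resDIV_trans : ∀ {i j k} (hij : L.closure j ≤ L.closure i) (hjk : L.closure k ≤ L.closure j) (d : (Z i).DIV),
    resDIV (hjk.trans hij) d = resDIV hjk (resDIV hij d)
  /-- pull-back of functions is injective (dominant covering) -/
  resFn_injective : ∀ {i j} (h : L.closure j ≤ L.closure i), Injective (resFn h)
  /-- log-meromorphic to log-meromorphic -/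
  resFn_mem_logMero : ∀ {i j} (h : L.closure j ≤ L.closure i) {f}, f ∈ (Z i).logMero → resFn h f ∈ (Z j).logMero
  /-- constants to constants -/
  resFn_mem_const : ∀ {i j} (h : L.closure j ≤ L.closure i) {f}, f ∈ (Z i).const → resFn h f ∈ (Z j).const
  /-- integral constants to integral constants -/
  resFn_mem_intConst : ∀ {i j} (h : L.closure j ≤ L.closure i) {f}, f ∈ (Z i).intConst → resFn h f ∈ (Z j).intConst
  /-- effective to effective -/
  resDIV_mem_DIVplus : ∀ {i j} (h : L.closure j ≤ L.closure i) {d}, d ∈ (Z i).DIVplus → resDIV h d ∈ (Z j).DIVplus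
  /-- Cartier to Cartier -/
  resDIV_mem_Div : ∀ {i j} (h : L.closure j ≤ L.closure i) {d}, d ∈ (Z i).Div → resDIV h d ∈ (Z j).Div
  /-- non-cuspidal to non-cuspidal (special fibre to special fibre) -/
  resDIV_mem_nonCuspidal : ∀ {i j} (h : L.closure j ≤ L.closure i) {d},
    d ∈ (Z i).nonCuspidal → resDIV h d ∈ (Z j).nonCuspidal
  /-- cuspidal to cuspidal (cusps to cusps) -/
  resDIV_mem_cuspidal : ∀ {i j} (h : L.closure j ≤ L.closure i) {d}, d ∈ (Z i).cuspidal → resDIV h d ∈ (Z j).cuspidal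
  /-- divisor of a pulled-back function = pull-back of its divisor -/
  divisor_resFn : ∀ {i j} (h : L.closure j ≤ L.closure i) (f : (Z i).logMero),
    (Z j).divisor ⟨resFn h f, resFn_mem_logMero h f.2⟩ = resDIV h ((Z i).divisor f)
  /-- pull-back of functions is `Π`-equivariant -/
  resFn_act : ∀ {i j} (h : L.closure j ≤ L.closure i) (g : P) (f : (Z i).Fn),
    resFn h ((act i).actFn g f) = (act j).actFn g (resFn h f)
  /-- pull-back of log-divisors is `Π`-equivariant -/
  resDIV_act : ∀ {i j} (h : L.closure j ≤ L.closure i) (g : P) (d : (Z i).DIV),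
    resDIV h ((act i).actDIV g d) = (act j).actDIV g (resDIV h d)

namespace LogDivisorTower

variable {P : Type u} [Group P] [TopologicalSpace P] {L : LevelSystem P} (T : LogDivisorTower P L)

/-! ### §2 Level change on `Φ₀` and `B₀` -/

section Trans

variable {i j : L.I} (h : L.closure j ≤ L.closure i) (S : Action (Type u) P)

/-- Pull-back preserves effective Cartier log-divisors. [cite: MochizukiEtTh2009, Def 3.3 (iii) p.73] -/
theorem resDIV_mem_Divplus {d : (T.Z i).DIV} (hd : d ∈ (T.Z i).Divplus) : T.resDIV h d ∈ (T.Z j).Divplus :=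
  ⟨T.resDIV_mem_Div h hd.1, T.resDIV_mem_DIVplus h hd.2⟩

/-- **Level change on `Φ₀`**: `Hom_Π(S, Div⁺(Z_∞^{(i)})) → Hom_Π(S, Div⁺(Z_∞^{(j)}))`, `φ ↦ resDIV ∘ φ`.
[cite: MochizukiEtTh2009, Def 3.3 (iii) p.73] -/
def transPhi : (T.act i).phiZero S →* (T.act j).phiZero S where
  toFun φ := ⟨fun s => T.resDIV h (φ.1 s), fun s => T.resDIV_mem_Divplus h (φ.2.1 s), fun g s => by
    show T.resDIV h (φ.1 (S.ρ g s)) = _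
    rw [φ.2.2, T.resDIV_act]⟩
  map_one' := Subtype.ext (funext fun _ => by
    show T.resDIV h ((1 : (T.act i).phiZero S).1 _) = 1
    exact map_one _)
  map_mul' φ ψ := Subtype.ext (funext fun _ => by
    show T.resDIV h ((φ * ψ).1 _) = T.resDIV h (φ.1 _) * T.resDIV h (ψ.1 _)
    exact map_mul _ _ _)

/-- `transPhi`, pointwise. [cite: MochizukiEtTh2009, Def 3.3 (iii) p.73] -/
@[simp] theorem transPhi_apply (φ : (T.act i).phiZero S) (s : S.V) : (T.transPhi h S φ).1 s = T.resDIV h (φ.1 s) := rfl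

/-- **Level change on `B₀`**: `Hom_Π(S, Mero(Z_∞^{(i)})) → Hom_Π(S, Mero(Z_∞^{(j)}))`, `b ↦ resFn ∘ b`.
[cite: MochizukiEtTh2009, Def 3.3 (iii) p.73] -/
def transB : (T.act i).bZero S →* (T.act j).bZero S where
  toFun b := ⟨fun s => T.resFn h (b.1 s), fun s => T.resFn_mem_logMero h (b.2.1 s), fun g s => by
    show T.resFn h (b.1 (S.ρ g s)) = _
    rw [b.2.2, T.resFn_act]⟩
  map_one' := Subtype.ext (funext fun _ => by
    show T.resFn h ((1 : (T.act i).bZero S).1 _) = 1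
    exact map_one _)
  map_mul' b c := Subtype.ext (funext fun _ => by
    show T.resFn h ((b * c).1 _) = T.resFn h (b.1 _) * T.resFn h (c.1 _)
    exact map_mul _ _ _)

/-- `transB`, pointwise. [cite: MochizukiEtTh2009, Def 3.3 (iii) p.73] -/
@[simp] theorem transB_apply (b : (T.act i).bZero S) (s : S.V) : (T.transB h S b).1 s = T.resFn h (b.1 s) := rfl

/-- Level change on `B₀` is injective (`resFn` is). [cite: MochizukiEtTh2009, Def 3.3 (iii) p.73] -/
theorem transB_injective : Injective (T.transB h S) := fun b c hbc =>
  Subtype.ext (funext fun s => T.resFn_injective h (by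
    have := congrArg (fun x : (T.act j).bZero S => x.1 s) hbc
    exact this))

end Trans

/-- `transPhi` at the same level is the identity. [cite: MochizukiEtTh2009, Def 3.3 (iii) p.73] -/
theorem transPhi_refl (i : L.I) (S : Action (Type u) P) (φ : (T.act i).phiZero S) :
    T.transPhi (le_refl (L.closure i)) S φ = φ :=
  Subtype.ext (funext fun s => T.resDIV_refl i (φ.1 s))

/-- `transB` at the same level is the identity. [cite: MochizukiEtTh2009, Def 3.3 (iii) p.73] -/
theorem transB_refl (i : L.I) (S : Action (Type u) P) (b : (T.act i).bZero S) :
    T.transB (le_refl (L.closure i)) S b = b :=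
  Subtype.ext (funext fun s => T.resFn_refl i (b.1 s))

/-- `transPhi` composes along the tower. [cite: MochizukiEtTh2009, Def 3.3 (iii) p.73] -/
theorem transPhi_trans {i j k : L.I} (hij : L.closure j ≤ L.closure i) (hjk : L.closure k ≤ L.closure j)
    (S : Action (Type u) P) (φ : (T.act i).phiZero S) :
    T.transPhi (hjk.trans hij) S φ = T.transPhi hjk S (T.transPhi hij S φ) :=
  Subtype.ext (funext fun s => T.resDIV_trans hij hjk (φ.1 s))

/-- `transB` composes along the tower. [cite: MochizukiEtTh2009, Def 3.3 (iii) p.73] -/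
theorem transB_trans {i j k : L.I} (hij : L.closure j ≤ L.closure i) (hjk : L.closure k ≤ L.closure j)
    (S : Action (Type u) P) (b : (T.act i).bZero S) :
    T.transB (hjk.trans hij) S b = T.transB hjk S (T.transB hij S b) :=
  Subtype.ext (funext fun s => T.resFn_trans hij hjk (b.1 s))

/-- Level change commutes with pull-back along covering maps (both are «compose with»).
[cite: MochizukiEtTh2009, Def 3.3 (iii) p.73] -/
theorem transPhi_phiZeroPull {i j : L.I} (h : L.closure j ≤ L.closure i) {S S' : Action (Type u) P} (f : S ⟶ S')
    (φ : (T.act i).phiZero S') :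
    T.transPhi h S ((T.act i).phiZeroPull f φ) = (T.act j).phiZeroPull f (T.transPhi h S' φ) :=
  Subtype.ext (funext fun _ => rfl)

/-- Level change commutes with pull-back along covering maps, for functions.
[cite: MochizukiEtTh2009, Def 3.3 (iii) p.73] -/
theorem transB_bZeroPull {i j : L.I} (h : L.closure j ≤ L.closure i) {S S' : Action (Type u) P} (f : S ⟶ S')
    (b : (T.act i).bZero S') :
    T.transB h S ((T.act i).bZeroPull f b) = (T.act j).bZeroPull f (T.transB h S' b) :=
  Subtype.ext (funext fun _ => rfl)

/-- **«Divisor of zeroes and poles» commutes with level change**: `div₀(resFn ∘ b) = (transPhi)^gp (div₀ b)`.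
[cite: MochizukiEtTh2009, Def 3.3 (iii) p.73] -/
theorem divZeroHom_transB {i j : L.I} (h : L.closure j ≤ L.closure i) (S : Action (Type u) P)
    (b : (T.act i).bZero S) :
    (T.act j).divZeroHom S (T.transB h S b) = gpMap (T.transPhi h S) ((T.act i).divZeroHom S b) := by
  change (T.act j).divZero S (T.transB h S b) = gpMap (T.transPhi h S) ((T.act i).divZero S b)
  conv_rhs => rw [LogDivisorModel.GaloisAction.divZero, map_div, gpMap_of, gpMap_of]
  rw [LogDivisorModel.GaloisAction.divZero_eq_div_iff]
  intro s
  change (T.Z j).divisor ⟨T.resFn h (b.1 s), _⟩ * T.resDIV h (((T.act i).divDen S b).1 s) =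
    T.resDIV h (((T.act i).divNum S b).1 s)
  rw [T.divisor_resFn h ⟨b.1 s, b.2.1 s⟩, ← map_mul]
  exact congrArg (T.resDIV h) ((T.act i).divAt_mul_divDen S b s)

/-! ### §3 Def. 3.3 (iii) over `D₀ = B^temp(Π)⁰`, each covering read at ITS level -/

section OfTower

/-- The underlying `Π`-set of a connected tempered covering (object of `B^temp(Π)⁰`). [cite: MochizukiFrdII2008, Ex 1.3 (ii) p.11] -/
abbrev gset (Y : ConnectedPart (BTemp P)) : Action (Type u) P := Y.obj.obj

/-- **`Φ₀ : D₀ → Mon` of Def. 3.3 (iii), v2**: `Φ₀(Y) = Hom_Π(Y, Div⁺(Z_∞^{(lvl Y)}))` — effective Cartier log-divisors on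
the `Δ^fil`-closure OF `Y` — and for a covering map `Y' → Y` the pull-back followed by the level change
`Z_∞^{(lvl Y')} → Z_∞^{(lvl Y)}` («by (i), (c), the assignments … determine functors»). [cite: MochizukiEtTh2009, Def 3.3 (iii) p.74] -/
def PhiZero : (ConnectedPart (BTemp P))ᵒᵖ ⥤ CommMonCat.{u} where
  obj Y := CommMonCat.of ((T.act (L.lvl Y.unop)).phiZero (gset Y.unop))
  map {Y Y'} f := CommMonCat.ofHom
    ((T.transPhi (L.closure_lvl_mono f.unop) (gset Y'.unop)).comp ((T.act (L.lvl Y.unop)).phiZeroPull f.unop.hom.hom))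
  map_id Y := by
    refine CommMonCat.hom_ext (MonoidHom.ext fun φ => Subtype.ext (funext fun s => ?_))
    exact T.resDIV_refl _ _
  map_comp f g := by
    refine CommMonCat.hom_ext (MonoidHom.ext fun φ => Subtype.ext (funext fun s => ?_))
    exact T.resDIV_trans _ _ _

/-- **`B₀ : D₀ → Mon` of Def. 3.3 (iii), v2**: `B₀(Y) = Hom_Π(Y, Mero(Z_∞^{(lvl Y)}))` — its value group CHANGES with
`Y` — and `B₀(Y' → Y)` = pull-back followed by the pull-back of functions along `Z_∞^{(lvl Y')} → Z_∞^{(lvl Y)}`.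
[cite: MochizukiEtTh2009, Def 3.3 (iii) p.74] -/
def BZero : (ConnectedPart (BTemp P))ᵒᵖ ⥤ CommMonCat.{u} where
  obj Y := CommMonCat.of ((T.act (L.lvl Y.unop)).bZero (gset Y.unop))
  map {Y Y'} f := CommMonCat.ofHom
    ((T.transB (L.closure_lvl_mono f.unop) (gset Y'.unop)).comp ((T.act (L.lvl Y.unop)).bZeroPull f.unop.hom.hom))
  map_id Y := by
    refine CommMonCat.hom_ext (MonoidHom.ext fun b => Subtype.ext (funext fun s => ?_))
    exact T.resFn_refl _ _
  map_comp f g := by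
    refine CommMonCat.hom_ext (MonoidHom.ext fun b => Subtype.ext (funext fun s => ?_))
    exact T.resFn_trans _ _ _

/-- `Φ₀` on morphisms, pointwise: pull back, then change level. [cite: MochizukiEtTh2009, Def 3.3 (iii) p.74] -/
theorem PhiZero_map_apply {Y Y' : (ConnectedPart (BTemp P))ᵒᵖ} (f : Y ⟶ Y')
    (φ : (T.act (L.lvl Y.unop)).phiZero (gset Y.unop)) (s : (gset Y'.unop).V) :
    ((T.PhiZero.map f).hom φ).1 s = T.resDIV (L.closure_lvl_mono f.unop) (φ.1 (f.unop.hom.hom.hom s)) := rfl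

/-- `B₀` on morphisms, pointwise. [cite: MochizukiEtTh2009, Def 3.3 (iii) p.74] -/
theorem BZero_map_apply {Y Y' : (ConnectedPart (BTemp P))ᵒᵖ} (f : Y ⟶ Y')
    (b : (T.act (L.lvl Y.unop)).bZero (gset Y.unop)) (s : (gset Y'.unop).V) :
    ((T.BZero.map f).hom b).1 s = T.resFn (L.closure_lvl_mono f.unop) (b.1 (f.unop.hom.hom.hom s)) := rfl

end OfTower

end LogDivisorTower

namespace DivisorMonoids

variable {P : Type u} [Group P] [TopologicalSpace P] {L : LevelSystem P} (T : LogDivisorTower P L)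

open LogDivisorTower

/-- **Def. 3.3 (iii) over print's `D₀ = B^temp(Π^tp_X)⁰`, v2 (covering-indexed `Mero`)**: the `DivisorMonoids` record
whose `Φ₀(Y)`, `B₀(Y)` are the invariants on the `Δ^fil`-closure `Z_∞^{(lvl Y)}` OF `Y`, `div₀` = «log-divisor of zeroes
and poles» at that level (natural in `Y`: pull-back AND level change commute with it), `F₀` = constant values,
`ncsp₀`/`csp₀` = non-cuspidal/cuspidal values with the unique decomposition (per-level cusp laws).  Every field is a
definition or a theorem over abc-iut-w6-d058's per-level API. [cite: MochizukiEtTh2009, Def 3.3 (iii) p.73] -/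
def ofTower : DivisorMonoids.{u + 1, u, u} (ConnectedPart (BTemp P)) where
  Φ₀ := T.PhiZero
  B₀ := T.BZero
  isUnit_B₀ Y b := by
    change IsUnit (M := (T.act (L.lvl Y.unop)).bZero (gset Y.unop)) b
    exact Group.isUnit _
  div₀ Y := (T.act (L.lvl Y.unop)).divZeroHom (gset Y.unop)
  div₀_natural {Y Y'} f b := by
    change (T.act (L.lvl Y'.unop)).divZeroHom (gset Y'.unop)
        (T.transB (L.closure_lvl_mono f.unop) (gset Y'.unop)
          ((T.act (L.lvl Y.unop)).bZeroPull f.unop.hom.hom b)) =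
      gpMap ((T.transPhi (L.closure_lvl_mono f.unop) (gset Y'.unop)).comp
          ((T.act (L.lvl Y.unop)).phiZeroPull f.unop.hom.hom))
        ((T.act (L.lvl Y.unop)).divZeroHom (gset Y.unop) b)
    rw [T.divZeroHom_transB, gpMap_comp_apply'', LogDivisorModel.GaloisAction.divZeroHom_apply,
      LogDivisorModel.GaloisAction.divZeroHom_apply, LogDivisorModel.GaloisAction.divZero_pull]
  F₀ Y := (T.act (L.lvl Y.unop)).fZero (gset Y.unop)
  F₀_map {Y Y'} f b hb s := T.resFn_mem_const _ (hb _)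
  ncsp₀ Y := (T.act (L.lvl Y.unop)).ncspZero (gset Y.unop)
  csp₀ Y := (T.act (L.lvl Y.unop)).cspZero (gset Y.unop)
  ncsp₀_map {Y Y'} f x hx s := T.resDIV_mem_nonCuspidal _ (hx _)
  csp₀_map {Y Y'} f x hx s := T.resDIV_mem_cuspidal _ (hx _)
  existsUnique_ncsp_csp Y x := (T.act (L.lvl Y.unop)).existsUnique_ncsp_csp (gset Y.unop) (T.cuspLaws _) x

end DivisorMonoids

/-! ### §4 One-level towers: v1 embeds in v2 (and v2 is inhabited) -/


namespace LogDivisorTower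

variable {P : Type u} [Group P] [TopologicalSpace P]

/-- **v1 embeds in v2**: a v1 datum (`LogDivisorModel` + `GaloisAction` + cusp laws) IS a one-level tower with identity
pull-backs. [cite: MochizukiEtTh2009, Def 3.3 (iii) p.73] -/
def ofGaloisAction {Z : LogDivisorModel.{u}} (A : Z.GaloisAction P) (hZ : Z.CuspLaws) :
    LogDivisorTower P (LevelSystem.single P) where
  Z _ := Z
  cuspLaws _ := hZ
  act _ := A
  act_closure_fn _ g hg := by
    change g ∈ (⊥ : Subgroup P) at hg
    rw [Subgroup.mem_bot] at hg
    rw [hg, map_one]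
  act_closure_div _ g hg := by
    change g ∈ (⊥ : Subgroup P) at hg
    rw [Subgroup.mem_bot] at hg
    rw [hg, map_one]
  resFn _ := MonoidHom.id _
  resDIV _ := MonoidHom.id _
  resFn_refl _ _ := rfl
  resFn_trans _ _ _ := rfl
  resDIV_refl _ _ := rfl
  resDIV_trans _ _ _ := rfl
  resFn_injective _ := injective_id
  resFn_mem_logMero _ _ h := h
  resFn_mem_const _ _ h := h
  resFn_mem_intConst _ _ h := h
  resDIV_mem_DIVplus _ _ h := h
  resDIV_mem_Div _ _ h := h
  resDIV_mem_nonCuspidal _ _ h := h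
  resDIV_mem_cuspidal _ _ h := h
  divisor_resFn _ _ := rfl
  resFn_act _ _ _ := rfl
  resDIV_act _ _ _ := rfl

/-- **The v2 record of a one-level tower IS the v1 record over the genuine base**: `B₀(Y) = Hom_Π(Y, Mero(Z_∞))` for
every connected tempered covering `Y` — abc-iut-w6-d058's `BZero` evaluated at the underlying `Π`-set (so every v1
theorem «at `ofGaloisAction`» is the one-level case of v2). [cite: MochizukiEtTh2009, Def 3.3 (iii) p.73] -/
theorem ofTower_ofGaloisAction_B₀_obj {Z : LogDivisorModel.{u}} (A : Z.GaloisAction P) (hZ : Z.CuspLaws)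
    (Y : (ConnectedPart (BTemp P))ᵒᵖ) :
    (DivisorMonoids.ofTower (ofGaloisAction A hZ)).B₀.obj Y = A.BZero.obj (op (gset Y.unop)) := rfl

/-- Same for `Φ₀`. [cite: MochizukiEtTh2009, Def 3.3 (iii) p.73] -/
theorem ofTower_ofGaloisAction_Φ₀_obj {Z : LogDivisorModel.{u}} (A : Z.GaloisAction P) (hZ : Z.CuspLaws)
    (Y : (ConnectedPart (BTemp P))ᵒᵖ) :
    (DivisorMonoids.ofTower (ofGaloisAction A hZ)).Φ₀.obj Y = A.PhiZero.obj (op (gset Y.unop)) := rfl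

/-- Same for `div₀`. [cite: MochizukiEtTh2009, Def 3.3 (iii) p.73] -/
theorem ofTower_ofGaloisAction_div₀ {Z : LogDivisorModel.{u}} (A : Z.GaloisAction P) (hZ : Z.CuspLaws)
    (Y : (ConnectedPart (BTemp P))ᵒᵖ) :
    (DivisorMonoids.ofTower (ofGaloisAction A hZ)).div₀ Y = A.divZeroHom (gset Y.unop) := rfl

/-- **The v2 interface is inhabited** (by the one-level tower of any v1 model, e.g. abc-iut-w6-d058's Tate tower or the
trivial action on `toy`). [cite: MochizukiEtTh2009, Def 3.3 (iii) p.73] -/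
theorem nonempty (P : Type) [Group P] [TopologicalSpace P] : Nonempty (LogDivisorTower P (LevelSystem.single P)) :=
  ⟨ofGaloisAction (LogDivisorModel.GaloisAction.trivial LogDivisorModel.toy P) LogDivisorModel.cuspLaws_toy⟩

end LogDivisorTower

end Literature.AnabelianGeometry.EtaleTheta

end
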